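import Summits.QuantumFields.BalabanUV.Beta.GAN24.T2RecChargeStep

/-!
# `BalabanUV.Beta.GAN24.T2RecChargeLedger` — binder row G-an2-4 ∕ (CONV-C), CT-W (F2): **THE `j`-TELESCOPED CHARGE LEDGER OF an2's DRESSED COMB TOWER
# AND ITS STAKES** — `zmodeSym_Lc (T̃_n) = λ′^n·zmodeSym_Lc (T̃_0) + Σ_{l<n} λ′^{n−1−l}·zmodeSym_Lc (σ_l)` with `σ_l := T̃_{l+1} − 𝒜^B_l T̃_l` the B-frame sources,
# `λ′ = cE₂·Lc^{d+1}·Lc^{2(d+1)}·Lc^{−4(d+2)}` (= 1 at the pin `cE₂ = Lc^{d+5}`, i.e. `Lc⁸` at `d = 3`); hence «T2Shape» FORCES BOUNDED CUMULATIVE SOURCE CHARGES,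
# and a persistent charge defect of one sign REFUTES «T2Shape» — Part 4 of `T2RecChargeStep`

NOT IN PRINT; OUR BOOKKEEPING (road-P2 chair of row G-an2-4, unit `b2b-balaban-gan24-p2` gen 36, crux team (2); idea-1 g29's `WARD2-GAN24.md` §2 (2.3) in the
kernel).  HONEST FRAMING (cell contract, verbatim): «discharging `BetaPertH` makes Bałaban's UV stability UNCONDITIONAL — a real constructive-QFT result; it is
NOT the continuum limit and NOT the Clay problem.»  HONEST DEPENDENCY (verbatim): «continuum YM on T⁴ ⇐ BetaPertH ∧ nine spine estimates (0/9 proved); BetaPertH ⇐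
(D1) ∧ (D4) ∧ CAP+tail; G-an2-4 gates asym, D1 and NE2/3/4.»

WHAT (generic `d`, in-block root, all constants symbolic; the pin enters ONLY as the displayed hypothesis `hpinEq : cE₂ = Lc^{d+5}` where said; [folklore]; 0 `def`,
0 cite, 0 `def … : Prop`, 0 sorry):
* §1 `affine_scalar_unroll`, `affine_scalar_unroll_one` — `Q (n+1) = λ·Q n + q n ⇒ Q n = λ^n·Q 0 + Σ_{l<n} λ^{n−1−l}·q l` (real sequences).
* §2 **`abs_zmode_le`** — `|zmode N X κ κ′ a b| ≤ N^{d+1}·(C·Zl δ³)` for `LocStencil₂ X C δ`, `δ > 0` (leaf-16's `TransversalZeroModeLoc.abs_inner_le` summed over the cell).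
* §3 `charge_factor_eq_one_of_pinEq` (`cE₂ = Lc^{d+5} ⇒ λ′ = 1`), **`zmodeSym_succ_eq_sourceB`** (Part 1 §3 rearranged: `zmodeSym_Lc (T̃_{j+1}) = λ′·zmodeSym_Lc (T̃_j) +
  zmodeSym_Lc (σ_j)`), **`zmodeSym_tower_eq`** (the telescoped ledger), **`zmodeSym_tower_eq_pin`** (`= zmodeSym_Lc (T̃_0) + Σ_{l<n} zmodeSym_Lc (σ_l)` at the pin).
* §4 THE STAKES: **`abs_sum_sourceB_le_of_t2Shape`** — at the pin, «T2Shape» of the dressed comb tower (`∃ C₂ δ₂ > 0, ∀ n, LocStencil₂ T̃_n C₂ δ₂`) ⇒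
  `|Σ_{l<n} zmodeSym_Lc (σ_l)(μ,ν;α,β)| ≤ 4·Lc^{d+1}·C₂·Zl δ₂³` for every `n` and pattern; **`not_t2Shape_of_persistent_charge`** — if some pattern's B-frame source
  charge stays `≥ q > 0` at every level (the `≤ −q` case is the same statement for the negated bound, not typed), «T2Shape» is FALSE.  (So R-gan24p1-g23-1's conservation (C_j) — `zmodeSym (σ_j) = 0` — is, cumulatively,
  NECESSARY for the D1 literal's «T2Shape» row at the pin; cf. my `zfreeSym_sourceB_iff`.)
Asserts NO value of Bałaban's tables; discharges NOTHING of (C), «T2Shape», «T2Drift», (hW, hWall); NEVER «G-an2-4 closed» as (CONV-C); NOT D1, NOT BetaPertH,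
NOT continuum, NOT Clay.  2026-08-22.
-/

noncomputable section

open Finset
open scoped BigOperators
open Literature.MathematicalPhysics.QuantumFieldTheory
open Literature.MathematicalPhysics.QuantumFieldTheory.Balaban1983to89
open Literature.MathematicalPhysics.QuantumFieldTheory.Balaban1983to89.Beta
open ExpKernelCalculus (MKer Decays shiftK Zl)
open OneStepResolventKernel (Fib)
open OneStepKernelFamily (KInvStep)
open AffineAveraging (Site box toSite)
open BalabanCompositeJets (LocStencil₂)
open AveragingMixedJetTables (mixFFAt)
open Summit.QuantumFields.BalabanUV.Beta.HessKerDressedUnits (unitK)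
open Summit.QuantumFields.BalabanUV.Beta.SecondOrderUnits (unitS₂)
open Summit.QuantumFields.BalabanUV.Beta.SpineRooted (T2RecAt)
open Summit.QuantumFields.BalabanUV.Beta.GAN24.CombesThomas (sfStep smStep)
open Summit.QuantumFields.BalabanUV.Beta.GAN24.T2RecursionAffine (lin4)
open Summit.QuantumFields.BalabanUV.Beta.GAN24.BiStencilZeroMode (Tab zmode)
open Summit.QuantumFields.BalabanUV.Beta.GAN24.TransversalZeroMode (card_box_succ)
open Summit.QuantumFields.BalabanUV.Beta.GAN24.TransversalZeroModeLoc (abs_inner_le)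
open Summit.QuantumFields.BalabanUV.Beta.GAN24.T2RecChargeStep (shape_member zmodeSym_sourceB_eq)

namespace Summit.QuantumFields.BalabanUV.Beta.GAN24.T2RecChargeLedger

variable {d : ℕ} {Lc : ℕ} [NeZero Lc] {r : Fin (d + 1) → ℕ}

/-! ## §1 Unrolling a scalar affine recursion -/

omit [NeZero Lc] in
/-- [folklore] **UNROLLING `Q (n+1) = λ·Q n + q n`**: `Q n = λ^n·Q 0 + Σ_{l<n} λ^{n−1−l}·q l`. -/
theorem affine_scalar_unroll (Q q : ℕ → ℝ) (lam : ℝ) (h : ∀ n, Q (n + 1) = lam * Q n + q n) :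
    ∀ n : ℕ, Q n = lam ^ n * Q 0 + ∑ l ∈ Finset.range n, lam ^ (n - 1 - l) * q l
  | 0 => by simp
  | n + 1 => by
    rw [h n, affine_scalar_unroll Q q lam h n, Finset.sum_range_succ, mul_add, Finset.mul_sum]
    have e : ∀ l ∈ Finset.range n, lam * (lam ^ (n - 1 - l) * q l) = lam ^ (n + 1 - 1 - l) * q l := by
      intro l hl
      rw [Finset.mem_range] at hl
      rw [← mul_assoc, ← pow_succ', show n - 1 - l + 1 = n + 1 - 1 - l by omega]
    rw [Finset.sum_congr rfl e, show n + 1 - 1 - n = 0 by omega, pow_zero, one_mul, pow_succ]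
    ring

omit [NeZero Lc] in
/-- [folklore] The case `λ = 1`: `Q n = Q 0 + Σ_{l<n} q l`. -/
theorem affine_scalar_unroll_one (Q q : ℕ → ℝ) (h : ∀ n, Q (n + 1) = Q n + q n) (n : ℕ) :
    Q n = Q 0 + ∑ l ∈ Finset.range n, q l := by
  have h' : ∀ n, Q (n + 1) = 1 * Q n + q n := fun n => by rw [one_mul]; exact h n
  have := affine_scalar_unroll Q q 1 h' n
  simpa only [one_pow, one_mul] using this

/-! ## §2 The zero-mode charge of a `LocStencil₂` table is bounded by its envelope constant -/

omit [NeZero Lc] in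
/-- [folklore] **`|zmode N X κ κ′ a b| ≤ N^{d+1}·(C·Zl δ³)`** for every `LocStencil₂ X C δ` with `δ > 0` (leaf-16's `abs_inner_le` at each of the `N^{d+1}` first
bonds of the cell). -/
theorem abs_zmode_le {X : Tab d} {C δ : ℝ} (hX : LocStencil₂ X C δ) (hδ : 0 < δ) (N : ℕ) (κ κ' : Fin (d + 1)) (a b : Fib d) :
    |zmode N X κ κ' a b| ≤ ((N : ℝ) ^ (d + 1)) * (C * Zl (d + 1) δ ^ 3) := by
  unfold zmode
  calc |∑ r ∈ box (d + 1) N, ∑' u', ∑' x, ∑' z, X κ (toSite r) κ' u' x z a b|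
      ≤ ∑ r ∈ box (d + 1) N, |∑' u', ∑' x, ∑' z, X κ (toSite r) κ' u' x z a b| := Finset.abs_sum_le_sum_abs _ _
    _ ≤ ∑ r ∈ box (d + 1) N, C * Zl (d + 1) δ ^ 3 := Finset.sum_le_sum fun r _ => abs_inner_le hX hδ κ (toSite r) κ' a b
    _ = ((N : ℝ) ^ (d + 1)) * (C * Zl (d + 1) δ ^ 3) := by
        rw [Finset.sum_const, card_box_succ, nsmul_eq_mul]
        push_cast
        ring

/-! ## §3 The telescoped charge ledger of the dressed comb tower -/

/-- [folklore] **THE PIN MAKES THE SYMMETRISED CHARGE FACTOR ONE**: `cE₂ = Lc^{d+5} ⇒ Lc^{d+1}·((cE₂·Lc^{2(d+1)})·((Lc^{d+2})⁻¹)^4) = 1` (exponent count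
`(d+1) + (d+5) + 2(d+1) − 4(d+2) = 0`; at `d = 3` the pin is the D1 literal's `cE₂ = Lc⁸`). -/
theorem charge_factor_eq_one_of_pinEq {cE₂ : ℝ} (hpinEq : cE₂ = (Lc : ℝ) ^ (d + 5)) :
    ((Lc : ℝ) ^ (d + 1)) * ((cE₂ * (Lc : ℝ) ^ (2 * (d + 1))) * (((Lc : ℝ) ^ (d + 1 + 1))⁻¹) ^ 4) = 1 := by
  have hL : (Lc : ℝ) ≠ 0 := Nat.cast_ne_zero.mpr (NeZero.ne Lc)
  rw [hpinEq]
  field_simp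
  ring

/-- NOT IN PRINT; OUR BOOKKEEPING (Part 1 §3 `zmodeSym_sourceB_eq` at `N := Lc`, rearranged).  **THE ONE-STEP SYMMETRISED CHARGE RECURSION IN THE B-FRAME**:
`zmodeSym_Lc (T̃_{j+1}) = λ′·zmodeSym_Lc (T̃_j) + zmodeSym_Lc (σ_j)`, `σ_j := T̃_{j+1} − lin4 c K♮_j Lc T̃_j`, `λ′ = Lc^{d+1}·(c·((Lc^{d+2})⁻¹)^4)`. -/
theorem zmodeSym_succ_eq_sourceB (hLc : 1 ≤ Lc) (hr : r ∈ box (d + 1) Lc) (cE cVH cΛ cE₂ cB : ℝ) (Tc : Fin 4 → Fin 4 → Fin 4 → Fin 4 → ℝ)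
    {vh₂S : Tab d} (hB : ∃ C δ : ℝ, 0 < δ ∧ LocStencil₂ vh₂S C δ)
    (hBt : ∀ (κ : Fin (d + 1)) (u : Fin (d + 1) → ℤ) (κ' : Fin (d + 1)) (u' t : Fin (d + 1) → ℤ),
      vh₂S κ (u + (Lc : ℤ) • t) κ' (u' + (Lc : ℤ) • t) = shiftK (-((Lc : ℤ) • t)) (vh₂S κ u κ' u'))
    (j : ℕ) (μ ν α β : Fin (d + 1)) :
    zmode Lc (unitS₂ (sfStep Lc (j + 1)) (smStep d Lc (j + 1)) (T2RecAt d Lc (toSite r) cE cVH cΛ cE₂ cB Tc vh₂S (mixFFAt (toSite r) Lc) (j + 1)))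
          μ ν (Sum.inl α) (Sum.inl β)
        + zmode Lc (unitS₂ (sfStep Lc (j + 1)) (smStep d Lc (j + 1)) (T2RecAt d Lc (toSite r) cE cVH cΛ cE₂ cB Tc vh₂S (mixFFAt (toSite r) Lc) (j + 1)))
          ν μ (Sum.inl α) (Sum.inl β)
      = ((Lc : ℝ) ^ (d + 1)) * ((cE₂ * (Lc : ℝ) ^ (2 * (d + 1))) * (((Lc : ℝ) ^ (d + 1 + 1))⁻¹) ^ 4) *
          (zmode Lc (unitS₂ (sfStep Lc j) (smStep d Lc j) (T2RecAt d Lc (toSite r) cE cVH cΛ cE₂ cB Tc vh₂S (mixFFAt (toSite r) Lc) j))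
              μ ν (Sum.inl α) (Sum.inl β)
            + zmode Lc (unitS₂ (sfStep Lc j) (smStep d Lc j) (T2RecAt d Lc (toSite r) cE cVH cΛ cE₂ cB Tc vh₂S (mixFFAt (toSite r) Lc) j))
              ν μ (Sum.inl α) (Sum.inl β))
        + (zmode Lc (fun κ u κ' u' =>
              unitS₂ (sfStep Lc (j + 1)) (smStep d Lc (j + 1)) (T2RecAt d Lc (toSite r) cE cVH cΛ cE₂ cB Tc vh₂S (mixFFAt (toSite r) Lc) (j + 1)) κ u κ' u'
            - lin4 (cE₂ * (Lc : ℝ) ^ (2 * (d + 1))) (unitK (sfStep Lc j) (smStep d Lc j) (KInvStep (d := d) Lc j)) Lc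
                (unitS₂ (sfStep Lc j) (smStep d Lc j) (T2RecAt d Lc (toSite r) cE cVH cΛ cE₂ cB Tc vh₂S (mixFFAt (toSite r) Lc) j)) κ u κ' u')
              μ ν (Sum.inl α) (Sum.inl β)
          + zmode Lc (fun κ u κ' u' =>
              unitS₂ (sfStep Lc (j + 1)) (smStep d Lc (j + 1)) (T2RecAt d Lc (toSite r) cE cVH cΛ cE₂ cB Tc vh₂S (mixFFAt (toSite r) Lc) (j + 1)) κ u κ' u'
            - lin4 (cE₂ * (Lc : ℝ) ^ (2 * (d + 1))) (unitK (sfStep Lc j) (smStep d Lc j) (KInvStep (d := d) Lc j)) Lc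
                (unitS₂ (sfStep Lc j) (smStep d Lc j) (T2RecAt d Lc (toSite r) cE cVH cΛ cE₂ cB Tc vh₂S (mixFFAt (toSite r) Lc) j)) κ u κ' u')
              ν μ (Sum.inl α) (Sum.inl β)) := by
  rw [zmodeSym_sourceB_eq hLc hr cE cVH cΛ cE₂ cB Tc hB hBt Lc j μ ν α β]
  ring

/-- NOT IN PRINT; OUR BOOKKEEPING.  **THE TELESCOPED CHARGE LEDGER OF THE DRESSED COMB TOWER** (§1 on §3's recursion):
`zmodeSym_Lc (T̃_n) = λ′^n·zmodeSym_Lc (T̃_0) + Σ_{l<n} λ′^{n−1−l}·zmodeSym_Lc (σ_l)` for every `n` and every pattern. -/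
theorem zmodeSym_tower_eq (hLc : 1 ≤ Lc) (hr : r ∈ box (d + 1) Lc) (cE cVH cΛ cE₂ cB : ℝ) (Tc : Fin 4 → Fin 4 → Fin 4 → Fin 4 → ℝ)
    {vh₂S : Tab d} (hB : ∃ C δ : ℝ, 0 < δ ∧ LocStencil₂ vh₂S C δ)
    (hBt : ∀ (κ : Fin (d + 1)) (u : Fin (d + 1) → ℤ) (κ' : Fin (d + 1)) (u' t : Fin (d + 1) → ℤ),
      vh₂S κ (u + (Lc : ℤ) • t) κ' (u' + (Lc : ℤ) • t) = shiftK (-((Lc : ℤ) • t)) (vh₂S κ u κ' u'))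
    (n : ℕ) (μ ν α β : Fin (d + 1)) :
    zmode Lc (unitS₂ (sfStep Lc n) (smStep d Lc n) (T2RecAt d Lc (toSite r) cE cVH cΛ cE₂ cB Tc vh₂S (mixFFAt (toSite r) Lc) n)) μ ν (Sum.inl α) (Sum.inl β)
        + zmode Lc (unitS₂ (sfStep Lc n) (smStep d Lc n) (T2RecAt d Lc (toSite r) cE cVH cΛ cE₂ cB Tc vh₂S (mixFFAt (toSite r) Lc) n)) ν μ (Sum.inl α) (Sum.inl β)
      = (((Lc : ℝ) ^ (d + 1)) * ((cE₂ * (Lc : ℝ) ^ (2 * (d + 1))) * (((Lc : ℝ) ^ (d + 1 + 1))⁻¹) ^ 4)) ^ n *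
          (zmode Lc (unitS₂ (sfStep Lc 0) (smStep d Lc 0) (T2RecAt d Lc (toSite r) cE cVH cΛ cE₂ cB Tc vh₂S (mixFFAt (toSite r) Lc) 0)) μ ν (Sum.inl α) (Sum.inl β)
            + zmode Lc (unitS₂ (sfStep Lc 0) (smStep d Lc 0) (T2RecAt d Lc (toSite r) cE cVH cΛ cE₂ cB Tc vh₂S (mixFFAt (toSite r) Lc) 0)) ν μ (Sum.inl α) (Sum.inl β))
        + ∑ l ∈ Finset.range n, (((Lc : ℝ) ^ (d + 1)) * ((cE₂ * (Lc : ℝ) ^ (2 * (d + 1))) * (((Lc : ℝ) ^ (d + 1 + 1))⁻¹) ^ 4)) ^ (n - 1 - l) *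
          (zmode Lc (fun κ u κ' u' =>
              unitS₂ (sfStep Lc (l + 1)) (smStep d Lc (l + 1)) (T2RecAt d Lc (toSite r) cE cVH cΛ cE₂ cB Tc vh₂S (mixFFAt (toSite r) Lc) (l + 1)) κ u κ' u'
            - lin4 (cE₂ * (Lc : ℝ) ^ (2 * (d + 1))) (unitK (sfStep Lc l) (smStep d Lc l) (KInvStep (d := d) Lc l)) Lc
                (unitS₂ (sfStep Lc l) (smStep d Lc l) (T2RecAt d Lc (toSite r) cE cVH cΛ cE₂ cB Tc vh₂S (mixFFAt (toSite r) Lc) l)) κ u κ' u')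
              μ ν (Sum.inl α) (Sum.inl β)
          + zmode Lc (fun κ u κ' u' =>
              unitS₂ (sfStep Lc (l + 1)) (smStep d Lc (l + 1)) (T2RecAt d Lc (toSite r) cE cVH cΛ cE₂ cB Tc vh₂S (mixFFAt (toSite r) Lc) (l + 1)) κ u κ' u'
            - lin4 (cE₂ * (Lc : ℝ) ^ (2 * (d + 1))) (unitK (sfStep Lc l) (smStep d Lc l) (KInvStep (d := d) Lc l)) Lc
                (unitS₂ (sfStep Lc l) (smStep d Lc l) (T2RecAt d Lc (toSite r) cE cVH cΛ cE₂ cB Tc vh₂S (mixFFAt (toSite r) Lc) l)) κ u κ' u')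
              ν μ (Sum.inl α) (Sum.inl β)) :=
  affine_scalar_unroll
    (fun n => zmode Lc (unitS₂ (sfStep Lc n) (smStep d Lc n) (T2RecAt d Lc (toSite r) cE cVH cΛ cE₂ cB Tc vh₂S (mixFFAt (toSite r) Lc) n)) μ ν (Sum.inl α) (Sum.inl β)
        + zmode Lc (unitS₂ (sfStep Lc n) (smStep d Lc n) (T2RecAt d Lc (toSite r) cE cVH cΛ cE₂ cB Tc vh₂S (mixFFAt (toSite r) Lc) n)) ν μ (Sum.inl α) (Sum.inl β))
    (fun l => zmode Lc (fun κ u κ' u' =>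
              unitS₂ (sfStep Lc (l + 1)) (smStep d Lc (l + 1)) (T2RecAt d Lc (toSite r) cE cVH cΛ cE₂ cB Tc vh₂S (mixFFAt (toSite r) Lc) (l + 1)) κ u κ' u'
            - lin4 (cE₂ * (Lc : ℝ) ^ (2 * (d + 1))) (unitK (sfStep Lc l) (smStep d Lc l) (KInvStep (d := d) Lc l)) Lc
                (unitS₂ (sfStep Lc l) (smStep d Lc l) (T2RecAt d Lc (toSite r) cE cVH cΛ cE₂ cB Tc vh₂S (mixFFAt (toSite r) Lc) l)) κ u κ' u')
              μ ν (Sum.inl α) (Sum.inl β)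
          + zmode Lc (fun κ u κ' u' =>
              unitS₂ (sfStep Lc (l + 1)) (smStep d Lc (l + 1)) (T2RecAt d Lc (toSite r) cE cVH cΛ cE₂ cB Tc vh₂S (mixFFAt (toSite r) Lc) (l + 1)) κ u κ' u'
            - lin4 (cE₂ * (Lc : ℝ) ^ (2 * (d + 1))) (unitK (sfStep Lc l) (smStep d Lc l) (KInvStep (d := d) Lc l)) Lc
                (unitS₂ (sfStep Lc l) (smStep d Lc l) (T2RecAt d Lc (toSite r) cE cVH cΛ cE₂ cB Tc vh₂S (mixFFAt (toSite r) Lc) l)) κ u κ' u')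
              ν μ (Sum.inl α) (Sum.inl β))
    _ (fun j => zmodeSym_succ_eq_sourceB hLc hr cE cVH cΛ cE₂ cB Tc hB hBt j μ ν α β) n

/-- NOT IN PRINT; OUR BOOKKEEPING.  **AT THE PIN THE LEDGER IS A PLAIN SUM**: `cE₂ = Lc^{d+5} ⇒ zmodeSym_Lc (T̃_n) = zmodeSym_Lc (T̃_0) + Σ_{l<n} zmodeSym_Lc (σ_l)`. -/
theorem zmodeSym_tower_eq_pin (hLc : 1 ≤ Lc) (hr : r ∈ box (d + 1) Lc) (cE cVH cΛ cE₂ cB : ℝ) (Tc : Fin 4 → Fin 4 → Fin 4 → Fin 4 → ℝ)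
    (hpinEq : cE₂ = (Lc : ℝ) ^ (d + 5))
    {vh₂S : Tab d} (hB : ∃ C δ : ℝ, 0 < δ ∧ LocStencil₂ vh₂S C δ)
    (hBt : ∀ (κ : Fin (d + 1)) (u : Fin (d + 1) → ℤ) (κ' : Fin (d + 1)) (u' t : Fin (d + 1) → ℤ),
      vh₂S κ (u + (Lc : ℤ) • t) κ' (u' + (Lc : ℤ) • t) = shiftK (-((Lc : ℤ) • t)) (vh₂S κ u κ' u'))
    (n : ℕ) (μ ν α β : Fin (d + 1)) :
    zmode Lc (unitS₂ (sfStep Lc n) (smStep d Lc n) (T2RecAt d Lc (toSite r) cE cVH cΛ cE₂ cB Tc vh₂S (mixFFAt (toSite r) Lc) n)) μ ν (Sum.inl α) (Sum.inl β)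
        + zmode Lc (unitS₂ (sfStep Lc n) (smStep d Lc n) (T2RecAt d Lc (toSite r) cE cVH cΛ cE₂ cB Tc vh₂S (mixFFAt (toSite r) Lc) n)) ν μ (Sum.inl α) (Sum.inl β)
      = (zmode Lc (unitS₂ (sfStep Lc 0) (smStep d Lc 0) (T2RecAt d Lc (toSite r) cE cVH cΛ cE₂ cB Tc vh₂S (mixFFAt (toSite r) Lc) 0)) μ ν (Sum.inl α) (Sum.inl β)
            + zmode Lc (unitS₂ (sfStep Lc 0) (smStep d Lc 0) (T2RecAt d Lc (toSite r) cE cVH cΛ cE₂ cB Tc vh₂S (mixFFAt (toSite r) Lc) 0)) ν μ (Sum.inl α) (Sum.inl β))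
        + ∑ l ∈ Finset.range n,
          (zmode Lc (fun κ u κ' u' =>
              unitS₂ (sfStep Lc (l + 1)) (smStep d Lc (l + 1)) (T2RecAt d Lc (toSite r) cE cVH cΛ cE₂ cB Tc vh₂S (mixFFAt (toSite r) Lc) (l + 1)) κ u κ' u'
            - lin4 (cE₂ * (Lc : ℝ) ^ (2 * (d + 1))) (unitK (sfStep Lc l) (smStep d Lc l) (KInvStep (d := d) Lc l)) Lc
                (unitS₂ (sfStep Lc l) (smStep d Lc l) (T2RecAt d Lc (toSite r) cE cVH cΛ cE₂ cB Tc vh₂S (mixFFAt (toSite r) Lc) l)) κ u κ' u')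
              μ ν (Sum.inl α) (Sum.inl β)
          + zmode Lc (fun κ u κ' u' =>
              unitS₂ (sfStep Lc (l + 1)) (smStep d Lc (l + 1)) (T2RecAt d Lc (toSite r) cE cVH cΛ cE₂ cB Tc vh₂S (mixFFAt (toSite r) Lc) (l + 1)) κ u κ' u'
            - lin4 (cE₂ * (Lc : ℝ) ^ (2 * (d + 1))) (unitK (sfStep Lc l) (smStep d Lc l) (KInvStep (d := d) Lc l)) Lc
                (unitS₂ (sfStep Lc l) (smStep d Lc l) (T2RecAt d Lc (toSite r) cE cVH cΛ cE₂ cB Tc vh₂S (mixFFAt (toSite r) Lc) l)) κ u κ' u')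
              ν μ (Sum.inl α) (Sum.inl β)) := by
  rw [zmodeSym_tower_eq hLc hr cE cVH cΛ cE₂ cB Tc hB hBt n μ ν α β, charge_factor_eq_one_of_pinEq (d := d) (Lc := Lc) hpinEq]
  simp only [one_pow, one_mul]

/-! ## §4 THE STAKES: «T2Shape» forces bounded cumulative B-frame source charges -/

/-- NOT IN PRINT; OUR BOOKKEEPING.  **«T2SHAPE» ⇒ THE CUMULATIVE B-FRAME SOURCE CHARGES ARE BOUNDED** (at the pin `cE₂ = Lc^{d+5}`): if the dressed comb tower
is ONE `LocStencil₂` family (`∀ n, LocStencil₂ T̃_n C₂ δ₂`, `δ₂ > 0` — the «T2Shape» row of the D1 literal at `d = 3`), then for every `n` and every pattern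
`|Σ_{l<n} zmodeSym_Lc (σ_l)(μ,ν;α,β)| ≤ 4·Lc^{d+1}·(C₂·Zl δ₂³)` (§3 at the pin + §2 twice at levels `n` and `0`). -/
theorem abs_sum_sourceB_le_of_t2Shape (hLc : 1 ≤ Lc) (hr : r ∈ box (d + 1) Lc) (cE cVH cΛ cE₂ cB : ℝ) (Tc : Fin 4 → Fin 4 → Fin 4 → Fin 4 → ℝ)
    (hpinEq : cE₂ = (Lc : ℝ) ^ (d + 5))
    {vh₂S : Tab d} (hB : ∃ C δ : ℝ, 0 < δ ∧ LocStencil₂ vh₂S C δ)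
    (hBt : ∀ (κ : Fin (d + 1)) (u : Fin (d + 1) → ℤ) (κ' : Fin (d + 1)) (u' t : Fin (d + 1) → ℤ),
      vh₂S κ (u + (Lc : ℤ) • t) κ' (u' + (Lc : ℤ) • t) = shiftK (-((Lc : ℤ) • t)) (vh₂S κ u κ' u'))
    {C₂ δ₂ : ℝ} (hδ₂ : 0 < δ₂)
    (hT2 : ∀ n, LocStencil₂ (unitS₂ (sfStep Lc n) (smStep d Lc n) (T2RecAt d Lc (toSite r) cE cVH cΛ cE₂ cB Tc vh₂S (mixFFAt (toSite r) Lc) n)) C₂ δ₂)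
    (n : ℕ) (μ ν α β : Fin (d + 1)) :
    |∑ l ∈ Finset.range n,
          (zmode Lc (fun κ u κ' u' =>
              unitS₂ (sfStep Lc (l + 1)) (smStep d Lc (l + 1)) (T2RecAt d Lc (toSite r) cE cVH cΛ cE₂ cB Tc vh₂S (mixFFAt (toSite r) Lc) (l + 1)) κ u κ' u'
            - lin4 (cE₂ * (Lc : ℝ) ^ (2 * (d + 1))) (unitK (sfStep Lc l) (smStep d Lc l) (KInvStep (d := d) Lc l)) Lc
                (unitS₂ (sfStep Lc l) (smStep d Lc l) (T2RecAt d Lc (toSite r) cE cVH cΛ cE₂ cB Tc vh₂S (mixFFAt (toSite r) Lc) l)) κ u κ' u')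
              μ ν (Sum.inl α) (Sum.inl β)
          + zmode Lc (fun κ u κ' u' =>
              unitS₂ (sfStep Lc (l + 1)) (smStep d Lc (l + 1)) (T2RecAt d Lc (toSite r) cE cVH cΛ cE₂ cB Tc vh₂S (mixFFAt (toSite r) Lc) (l + 1)) κ u κ' u'
            - lin4 (cE₂ * (Lc : ℝ) ^ (2 * (d + 1))) (unitK (sfStep Lc l) (smStep d Lc l) (KInvStep (d := d) Lc l)) Lc
                (unitS₂ (sfStep Lc l) (smStep d Lc l) (T2RecAt d Lc (toSite r) cE cVH cΛ cE₂ cB Tc vh₂S (mixFFAt (toSite r) Lc) l)) κ u κ' u')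
              ν μ (Sum.inl α) (Sum.inl β))|
      ≤ 4 * ((Lc : ℝ) ^ (d + 1)) * (C₂ * Zl (d + 1) δ₂ ^ 3) := by
  have hled := zmodeSym_tower_eq_pin hLc hr cE cVH cΛ cE₂ cB Tc hpinEq hB hBt n μ ν α β
  -- the sum is `zmodeSym T̃_n − zmodeSym T̃_0`
  have hsum : ∑ l ∈ Finset.range n,
          (zmode Lc (fun κ u κ' u' =>
              unitS₂ (sfStep Lc (l + 1)) (smStep d Lc (l + 1)) (T2RecAt d Lc (toSite r) cE cVH cΛ cE₂ cB Tc vh₂S (mixFFAt (toSite r) Lc) (l + 1)) κ u κ' u'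
            - lin4 (cE₂ * (Lc : ℝ) ^ (2 * (d + 1))) (unitK (sfStep Lc l) (smStep d Lc l) (KInvStep (d := d) Lc l)) Lc
                (unitS₂ (sfStep Lc l) (smStep d Lc l) (T2RecAt d Lc (toSite r) cE cVH cΛ cE₂ cB Tc vh₂S (mixFFAt (toSite r) Lc) l)) κ u κ' u')
              μ ν (Sum.inl α) (Sum.inl β)
          + zmode Lc (fun κ u κ' u' =>
              unitS₂ (sfStep Lc (l + 1)) (smStep d Lc (l + 1)) (T2RecAt d Lc (toSite r) cE cVH cΛ cE₂ cB Tc vh₂S (mixFFAt (toSite r) Lc) (l + 1)) κ u κ' u'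
            - lin4 (cE₂ * (Lc : ℝ) ^ (2 * (d + 1))) (unitK (sfStep Lc l) (smStep d Lc l) (KInvStep (d := d) Lc l)) Lc
                (unitS₂ (sfStep Lc l) (smStep d Lc l) (T2RecAt d Lc (toSite r) cE cVH cΛ cE₂ cB Tc vh₂S (mixFFAt (toSite r) Lc) l)) κ u κ' u')
              ν μ (Sum.inl α) (Sum.inl β))
      = (zmode Lc (unitS₂ (sfStep Lc n) (smStep d Lc n) (T2RecAt d Lc (toSite r) cE cVH cΛ cE₂ cB Tc vh₂S (mixFFAt (toSite r) Lc) n)) μ ν (Sum.inl α) (Sum.inl β)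
          + zmode Lc (unitS₂ (sfStep Lc n) (smStep d Lc n) (T2RecAt d Lc (toSite r) cE cVH cΛ cE₂ cB Tc vh₂S (mixFFAt (toSite r) Lc) n)) ν μ (Sum.inl α) (Sum.inl β))
        - (zmode Lc (unitS₂ (sfStep Lc 0) (smStep d Lc 0) (T2RecAt d Lc (toSite r) cE cVH cΛ cE₂ cB Tc vh₂S (mixFFAt (toSite r) Lc) 0)) μ ν (Sum.inl α) (Sum.inl β)
          + zmode Lc (unitS₂ (sfStep Lc 0) (smStep d Lc 0) (T2RecAt d Lc (toSite r) cE cVH cΛ cE₂ cB Tc vh₂S (mixFFAt (toSite r) Lc) 0)) ν μ (Sum.inl α) (Sum.inl β)) := by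
    rw [hled]; ring
  have hbn1 := abs_zmode_le (hT2 n) hδ₂ Lc μ ν (Sum.inl α) (Sum.inl β)
  have hbn2 := abs_zmode_le (hT2 n) hδ₂ Lc ν μ (Sum.inl α) (Sum.inl β)
  have hb01 := abs_zmode_le (hT2 0) hδ₂ Lc μ ν (Sum.inl α) (Sum.inl β)
  have hb02 := abs_zmode_le (hT2 0) hδ₂ Lc ν μ (Sum.inl α) (Sum.inl β)
  rw [hsum]
  calc _ ≤ |zmode Lc (unitS₂ (sfStep Lc n) (smStep d Lc n) (T2RecAt d Lc (toSite r) cE cVH cΛ cE₂ cB Tc vh₂S (mixFFAt (toSite r) Lc) n)) μ ν (Sum.inl α) (Sum.inl β)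
          + zmode Lc (unitS₂ (sfStep Lc n) (smStep d Lc n) (T2RecAt d Lc (toSite r) cE cVH cΛ cE₂ cB Tc vh₂S (mixFFAt (toSite r) Lc) n)) ν μ (Sum.inl α) (Sum.inl β)|
        + |zmode Lc (unitS₂ (sfStep Lc 0) (smStep d Lc 0) (T2RecAt d Lc (toSite r) cE cVH cΛ cE₂ cB Tc vh₂S (mixFFAt (toSite r) Lc) 0)) μ ν (Sum.inl α) (Sum.inl β)
          + zmode Lc (unitS₂ (sfStep Lc 0) (smStep d Lc 0) (T2RecAt d Lc (toSite r) cE cVH cΛ cE₂ cB Tc vh₂S (mixFFAt (toSite r) Lc) 0)) ν μ (Sum.inl α) (Sum.inl β)| :=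
          abs_sub _ _
    _ ≤ (|zmode Lc (unitS₂ (sfStep Lc n) (smStep d Lc n) (T2RecAt d Lc (toSite r) cE cVH cΛ cE₂ cB Tc vh₂S (mixFFAt (toSite r) Lc) n)) μ ν (Sum.inl α) (Sum.inl β)|
          + |zmode Lc (unitS₂ (sfStep Lc n) (smStep d Lc n) (T2RecAt d Lc (toSite r) cE cVH cΛ cE₂ cB Tc vh₂S (mixFFAt (toSite r) Lc) n)) ν μ (Sum.inl α) (Sum.inl β)|)
        + (|zmode Lc (unitS₂ (sfStep Lc 0) (smStep d Lc 0) (T2RecAt d Lc (toSite r) cE cVH cΛ cE₂ cB Tc vh₂S (mixFFAt (toSite r) Lc) 0)) μ ν (Sum.inl α) (Sum.inl β)|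
          + |zmode Lc (unitS₂ (sfStep Lc 0) (smStep d Lc 0) (T2RecAt d Lc (toSite r) cE cVH cΛ cE₂ cB Tc vh₂S (mixFFAt (toSite r) Lc) 0)) ν μ (Sum.inl α) (Sum.inl β)|) :=
          add_le_add (abs_add_le _ _) (abs_add_le _ _)
    _ ≤ 4 * ((Lc : ℝ) ^ (d + 1)) * (C₂ * Zl (d + 1) δ₂ ^ 3) := by linarith

/-- NOT IN PRINT; OUR BOOKKEEPING.  **A PERSISTENT ONE-SIGNED CHARGE DEFECT REFUTES «T2SHAPE»** (contrapositive of §4, Archimedes): at the pin, if for some pattern the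
B-frame source charge satisfies `q ≤ zmodeSym_Lc (σ_l)(μ,ν;α,β)` for all `l` with `q > 0`, then the dressed comb tower is NOT one `LocStencil₂` family at any
rate `δ₂ > 0` — i.e. R-gan24p1-g23-1's conservation `zmodeSym (σ_l) = 0` is (cumulatively, in this one-signed form) NECESSARY for the D1 literal's «T2Shape». -/
theorem not_t2Shape_of_persistent_charge (hLc : 1 ≤ Lc) (hr : r ∈ box (d + 1) Lc) (cE cVH cΛ cE₂ cB : ℝ) (Tc : Fin 4 → Fin 4 → Fin 4 → Fin 4 → ℝ)
    (hpinEq : cE₂ = (Lc : ℝ) ^ (d + 5))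
    {vh₂S : Tab d} (hB : ∃ C δ : ℝ, 0 < δ ∧ LocStencil₂ vh₂S C δ)
    (hBt : ∀ (κ : Fin (d + 1)) (u : Fin (d + 1) → ℤ) (κ' : Fin (d + 1)) (u' t : Fin (d + 1) → ℤ),
      vh₂S κ (u + (Lc : ℤ) • t) κ' (u' + (Lc : ℤ) • t) = shiftK (-((Lc : ℤ) • t)) (vh₂S κ u κ' u'))
    {μ ν α β : Fin (d + 1)} {q : ℝ} (hq : 0 < q)
    (hdef : ∀ l,
      q ≤ zmode Lc (fun κ u κ' u' =>
              unitS₂ (sfStep Lc (l + 1)) (smStep d Lc (l + 1)) (T2RecAt d Lc (toSite r) cE cVH cΛ cE₂ cB Tc vh₂S (mixFFAt (toSite r) Lc) (l + 1)) κ u κ' u'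
            - lin4 (cE₂ * (Lc : ℝ) ^ (2 * (d + 1))) (unitK (sfStep Lc l) (smStep d Lc l) (KInvStep (d := d) Lc l)) Lc
                (unitS₂ (sfStep Lc l) (smStep d Lc l) (T2RecAt d Lc (toSite r) cE cVH cΛ cE₂ cB Tc vh₂S (mixFFAt (toSite r) Lc) l)) κ u κ' u')
              μ ν (Sum.inl α) (Sum.inl β)
          + zmode Lc (fun κ u κ' u' =>
              unitS₂ (sfStep Lc (l + 1)) (smStep d Lc (l + 1)) (T2RecAt d Lc (toSite r) cE cVH cΛ cE₂ cB Tc vh₂S (mixFFAt (toSite r) Lc) (l + 1)) κ u κ' u'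
            - lin4 (cE₂ * (Lc : ℝ) ^ (2 * (d + 1))) (unitK (sfStep Lc l) (smStep d Lc l) (KInvStep (d := d) Lc l)) Lc
                (unitS₂ (sfStep Lc l) (smStep d Lc l) (T2RecAt d Lc (toSite r) cE cVH cΛ cE₂ cB Tc vh₂S (mixFFAt (toSite r) Lc) l)) κ u κ' u')
              ν μ (Sum.inl α) (Sum.inl β)) :
    ¬ ∃ C₂ δ₂ : ℝ, 0 < δ₂ ∧ ∀ n, LocStencil₂ (unitS₂ (sfStep Lc n) (smStep d Lc n)
        (T2RecAt d Lc (toSite r) cE cVH cΛ cE₂ cB Tc vh₂S (mixFFAt (toSite r) Lc) n)) C₂ δ₂ := by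
  rintro ⟨C₂, δ₂, hδ₂, hT2⟩
  set B : ℝ := 4 * ((Lc : ℝ) ^ (d + 1)) * (C₂ * Zl (d + 1) δ₂ ^ 3) with hBdef
  -- pick `n` with `n·q > B`
  obtain ⟨n, hn⟩ := exists_nat_gt (B / q)
  have hnq : B < (n : ℝ) * q := by rwa [div_lt_iff₀ hq] at hn
  have hle := abs_sum_sourceB_le_of_t2Shape hLc hr cE cVH cΛ cE₂ cB Tc hpinEq hB hBt hδ₂ hT2 n μ ν α β
  have hge : (n : ℝ) * q ≤ ∑ l ∈ Finset.range n,
          (zmode Lc (fun κ u κ' u' =>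
              unitS₂ (sfStep Lc (l + 1)) (smStep d Lc (l + 1)) (T2RecAt d Lc (toSite r) cE cVH cΛ cE₂ cB Tc vh₂S (mixFFAt (toSite r) Lc) (l + 1)) κ u κ' u'
            - lin4 (cE₂ * (Lc : ℝ) ^ (2 * (d + 1))) (unitK (sfStep Lc l) (smStep d Lc l) (KInvStep (d := d) Lc l)) Lc
                (unitS₂ (sfStep Lc l) (smStep d Lc l) (T2RecAt d Lc (toSite r) cE cVH cΛ cE₂ cB Tc vh₂S (mixFFAt (toSite r) Lc) l)) κ u κ' u')
              μ ν (Sum.inl α) (Sum.inl β)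
          + zmode Lc (fun κ u κ' u' =>
              unitS₂ (sfStep Lc (l + 1)) (smStep d Lc (l + 1)) (T2RecAt d Lc (toSite r) cE cVH cΛ cE₂ cB Tc vh₂S (mixFFAt (toSite r) Lc) (l + 1)) κ u κ' u'
            - lin4 (cE₂ * (Lc : ℝ) ^ (2 * (d + 1))) (unitK (sfStep Lc l) (smStep d Lc l) (KInvStep (d := d) Lc l)) Lc
                (unitS₂ (sfStep Lc l) (smStep d Lc l) (T2RecAt d Lc (toSite r) cE cVH cΛ cE₂ cB Tc vh₂S (mixFFAt (toSite r) Lc) l)) κ u κ' u')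
              ν μ (Sum.inl α) (Sum.inl β)) := by
    have h := Finset.sum_le_sum fun l (_ : l ∈ Finset.range n) => hdef l
    rw [Finset.sum_const, Finset.card_range, nsmul_eq_mul] at h
    exact h
  have := le_abs_self (∑ l ∈ Finset.range n,
          (zmode Lc (fun κ u κ' u' =>
              unitS₂ (sfStep Lc (l + 1)) (smStep d Lc (l + 1)) (T2RecAt d Lc (toSite r) cE cVH cΛ cE₂ cB Tc vh₂S (mixFFAt (toSite r) Lc) (l + 1)) κ u κ' u'
            - lin4 (cE₂ * (Lc : ℝ) ^ (2 * (d + 1))) (unitK (sfStep Lc l) (smStep d Lc l) (KInvStep (d := d) Lc l)) Lc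
                (unitS₂ (sfStep Lc l) (smStep d Lc l) (T2RecAt d Lc (toSite r) cE cVH cΛ cE₂ cB Tc vh₂S (mixFFAt (toSite r) Lc) l)) κ u κ' u')
              μ ν (Sum.inl α) (Sum.inl β)
          + zmode Lc (fun κ u κ' u' =>
              unitS₂ (sfStep Lc (l + 1)) (smStep d Lc (l + 1)) (T2RecAt d Lc (toSite r) cE cVH cΛ cE₂ cB Tc vh₂S (mixFFAt (toSite r) Lc) (l + 1)) κ u κ' u'
            - lin4 (cE₂ * (Lc : ℝ) ^ (2 * (d + 1))) (unitK (sfStep Lc l) (smStep d Lc l) (KInvStep (d := d) Lc l)) Lc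
                (unitS₂ (sfStep Lc l) (smStep d Lc l) (T2RecAt d Lc (toSite r) cE cVH cΛ cE₂ cB Tc vh₂S (mixFFAt (toSite r) Lc) l)) κ u κ' u')
              ν μ (Sum.inl α) (Sum.inl β)))
  linarith

end Summit.QuantumFields.BalabanUV.Beta.GAN24.T2RecChargeLedger

end
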